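import Summits.BirchSwinnertonDyer.BirchSwinnertonDyer.Theorems.ByReductionTypeAtTwoTowerTorsionCertificate
import Summits.BirchSwinnertonDyer.BirchSwinnertonDyer.Theorems.ByReductionTypeAtTwoTowerLayerFrobenius
import HarnessLib

/-!
# The Galois element of the torsion certificate: a FROBENIUS at an odd prime `ℓ` with
# `v₂(ℓ² − 1) ≥ j + 3` and `ℓ ∣ r^{(ℓ−1)/2} + 1`, `ℓ ∣ s^{(ℓ−1)/2} + 1` lies in `Gal(ℚ̄/ℚ_j)` and moves every
# square root of `r` and of `s` — hence `#E[2^∞]^{Gal(ℚ̄/ℚ_j)} ≤ 2` from THREE decidable integer facts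
# (route ByReductionTypeAtTwo, items 19577 / 19573; seat bsd-2adic-ord-3 GEN 6)

HONEST FRAMING (cell `bsd-2adic`, run/shared/lean/pub/bsd-2adic/, HUMAN RULINGS D-0036 / D-0054 / D-0074): THEOREMS
ONLY; nothing asserted; no definition; no named fact; closes nothing by itself. This file DISCHARGES the Galois
hypothesis (`hσ`, `hσr`, `hσs`) of `TowerLambdaTorsion.natCard_fixedBy_layerSubgroup_le_two`
(`Theorems/ByReductionTypeAtTwoTowerTorsionCertificate.lean`) from tower-1's cyclotomic bookkeeping and
Mathlib's arithmetic Frobenius: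

* the LOCAL arithmetic Frobenius `τ ∈ Γ_{ℚ_v}` (tree `exists_isAbsArithFrob_holds`) restricts to a GLOBAL
  `σ = res τ ∈ Γ_ℚ` which is an arithmetic Frobenius at the prime `𝔓₀ ∣ ℓ` of `ℤ̄ = absIntegers (𝓞 ℚ) ℚ`
  (`isArithFrobAt_absGaloisRestrict_adicCompletionPrime_iff`): `σ • x ≡ x^ℓ (mod 𝔓₀)` on `ℤ̄`;
* `‖κ(σ)‖ = 2^{−(v₂(ℓ²−1)−3)}` for the cyclotomic `ℤ₂`-extension `κ` (tower-1
  `TowerLayer.norm_toAdd_apply_resGal_of_isAbsArithFrob_two`), so `σ ∈ κ.layerSubgroup j` for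
  `j + 3 ≤ v₂(ℓ²−1)`, i.e. `ℓ ≡ ±1 (mod 2^{j+2})`;
* EULER (§1): for an integer `r` with `ℓ ∣ r^{⌊ℓ/2⌋} + 1` and `α ∈ ℚ̄` with `α² = r`: `α ∈ ℤ̄`,
  `α^ℓ = r^{⌊ℓ/2⌋} α ≡ −α (mod 𝔓₀)`, so `σ • α ≡ −α`; were `σ • α = α` then `2α ∈ 𝔓₀`, `4r ∈ 𝔓₀ ∩ ℤ = ℓℤ`,
  `ℓ ∣ r ∣ r^{⌊ℓ/2⌋}`, contradicting `ℓ ∣ r^{⌊ℓ/2⌋} + 1`.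
So (§3): **`#E[2^∞]^{Gal(ℚ̄/ℚ_j)} ≤ 2^1` for `W/ℚ` with a rational `2`-torsion abscissa `e₁`, from an odd prime
`ℓ` with `j + 3 ≤ v₂(ℓ²−1)`, `ℓ ∣ r^{⌊ℓ/2⌋} + 1`, `ℓ ∣ s^{⌊ℓ/2⌋} + 1`** (`r = ψ₂′(e₁)/4`, `s` the resolvent
discriminant, integers) — the `htor` input, `t = 1` at EVERY layer `j ≤ v₂(ℓ²−1) − 3`, of the torsion-tolerant
RANK certificate `towerRank_of_layerClasses_of_torsion` and of ord-2's gap doors on the even-torsion block.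
First consumer: 469737k1 (`ℓ = 127`, `v₂(127² − 1) = 8`, `r = 65367243`, `s = 539004658617`).
References: [SilvermanAEC2009] III.2.3 (d), VIII.§1; [NeukirchANT1999] Ch. I §9, Ch. II §9 (9.6);
[Washington1997] §13.1; [SerreAbelianLadic1968] Ch. I §1.2; [IrelandRosen1990] Prop. 5.1.1 (Euler's criterion).
-/

set_option autoImplicit false
-- the sub-problem namespace repeats the summit name by design (D-0017 nested layout)
set_option linter.dupNamespace false

noncomputable section

open scoped Classical

open NumberField IsDedekindDomain Field WeierstrassCurve Literature.NumberTheory.EllipticCurves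
  Literature.NumberTheory.GaloisRepresentations Rat.HeightOneSpectrum

namespace Summit.BirchSwinnertonDyer.BirchSwinnertonDyer.Theorems.TowerLambdaTorsion

/-! ## §1 Euler: an arithmetic Frobenius at `𝔓 ∣ ℓ` moves `√r` when `ℓ ∣ r^{⌊ℓ/2⌋} + 1` -/

/-- **An arithmetic Frobenius moves the square roots of a quadratic non-residue.** Let `σ ∈ Γ_ℚ` be an
arithmetic Frobenius (Mathlib `IsArithFrobAt`) at an ideal `𝔓` of `ℤ̄ = absIntegers (𝓞 ℚ) ℚ` with
`#(𝓞 ℚ ⧸ 𝔓 ∩ 𝓞 ℚ) = ℓ` and `𝔓 ∩ ℤ = ℓℤ`, `ℓ` an odd prime, and let `r ∈ ℤ` with `ℓ ∣ r^{⌊ℓ/2⌋} + 1` (Euler: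
`r` is a quadratic non-residue mod `ℓ`). Then `σ` fixes no `α ∈ ℚ̄` with `α² = r`.
[cite: IrelandRosen1990, Prop. 5.1.1] [cite: NeukirchANT1999, Ch. I §9 (the Frobenius automorphism)] -/
theorem algEquiv_apply_ne_of_isArithFrobAt {σ : absoluteGaloisGroup ℚ} {𝔓 : Ideal (absIntegers (𝓞 ℚ) ℚ)}
    (hfrob : IsArithFrobAt (𝓞 ℚ) σ 𝔓) {ℓ : ℕ} (hℓ : ℓ.Prime) (hℓ2 : ℓ ≠ 2)
    (hcard : Nat.card (𝓞 ℚ ⧸ 𝔓.under (𝓞 ℚ)) = ℓ)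
    (hmem : ∀ n : ℤ, ((n : 𝓞 ℚ) ∈ 𝔓.under (𝓞 ℚ)) ↔ (ℓ : ℤ) ∣ n)
    {r : ℤ} (hr : (ℓ : ℤ) ∣ r ^ (ℓ / 2) + 1) {α : AlgebraicClosure ℚ}
    (hα : α ^ 2 = algebraMap ℚ (AlgebraicClosure ℚ) r) :
    (show AlgebraicClosure ℚ ≃ₐ[ℚ] AlgebraicClosure ℚ from σ) α ≠ α := by
  -- `α` is integral: a root of `X² − r`
  have hαr : α ^ 2 = ((r : ℤ) : AlgebraicClosure ℚ) := by rw [hα, map_intCast]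
  have hint : IsIntegral (𝓞 ℚ) α := by
    refine IsIntegral.of_pow (n := 2) (by norm_num) ?_
    have h := isIntegral_algebraMap (R := 𝓞 ℚ) (A := AlgebraicClosure ℚ) (x := ((r : ℤ) : 𝓞 ℚ))
    rw [map_intCast] at h
    rwa [hαr]
  have hαA : α ∈ absIntegers (𝓞 ℚ) ℚ := hint
  let a : absIntegers (𝓞 ℚ) ℚ := ⟨α, hαA⟩
  -- arithmetic in `ℤ̄`
  have ha2 : a ^ 2 = ((r : ℤ) : absIntegers (𝓞 ℚ) ℚ) := by
    apply Subtype.ext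
    push_cast
    exact hαr
  have hℓmem : ((ℓ : ℤ) : absIntegers (𝓞 ℚ) ℚ) ∈ 𝔓 := by
    have h := (hmem ℓ).mpr dvd_rfl
    rwa [Ideal.under, Ideal.mem_comap, map_intCast] at h
  -- the Frobenius congruence `σ • a − a^ℓ ∈ 𝔓`
  have hF : σ • a - a ^ ℓ ∈ 𝔓 := by
    have h := hfrob a
    rw [hcard] at h
    exact h
  -- `ℓ` odd: `a^ℓ = r^{⌊ℓ/2⌋} · a`
  have hodd : Odd ℓ := hℓ.odd_of_ne_two hℓ2
  have hpow : a ^ ℓ = ((r ^ (ℓ / 2) : ℤ) : absIntegers (𝓞 ℚ) ℚ) * a := by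
    conv_lhs => rw [← Nat.two_mul_div_two_add_one_of_odd hodd]
    rw [pow_succ, pow_mul, ha2]
    push_cast
    ring
  -- Euler: `a^ℓ + a = (r^{⌊ℓ/2⌋} + 1) a ∈ ℓℤ̄ ⊆ 𝔓`
  have hE : a ^ ℓ + a ∈ 𝔓 := by
    obtain ⟨c, hc⟩ := id hr
    have h1 : a ^ ℓ + a = ((r ^ (ℓ / 2) + 1 : ℤ) : absIntegers (𝓞 ℚ) ℚ) * a := by
      rw [hpow]; push_cast; ring
    rw [h1, hc]
    push_cast
    rw [mul_assoc]
    exact Ideal.mul_mem_right _ _ hℓmem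
  -- hence `σ • a + a ∈ 𝔓`
  have hsum : σ • a + a ∈ 𝔓 := by
    have e : σ • a + a = (σ • a - a ^ ℓ) + (a ^ ℓ + a) := by ring
    rw [e]
    exact Ideal.add_mem _ hF hE
  -- if `σ` fixed `α`: `2a ∈ 𝔓`, `(2a)² = 4r ∈ 𝔓 ∩ ℤ`, `ℓ ∣ 4r`
  intro hfix
  have hfixA : σ • a = a := Subtype.ext hfix
  rw [hfixA] at hsum
  have h4r : ((4 * r : ℤ) : absIntegers (𝓞 ℚ) ℚ) ∈ 𝔓 := by
    have h := Ideal.mul_mem_left 𝔓 (a + a) hsum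
    have e : (a + a) * (a + a) = ((4 * r : ℤ) : absIntegers (𝓞 ℚ) ℚ) := by
      rw [show (a + a) * (a + a) = 4 * a ^ 2 by ring, ha2]; push_cast; ring
    rwa [e] at h
  have hdvd : (ℓ : ℤ) ∣ 4 * r := by
    refine (hmem (4 * r)).mp ?_
    rw [Ideal.under, Ideal.mem_comap, map_intCast]
    exact h4r
  -- an odd prime `ℓ` with `ℓ ∣ r^{⌊ℓ/2⌋} + 1` cannot divide `4r`
  have hℓprime : Prime (ℓ : ℤ) := Nat.prime_iff_prime_int.mp hℓ
  have hℓr : (ℓ : ℤ) ∣ r := by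
    rcases hℓprime.dvd_or_dvd hdvd with h4 | h4
    · exfalso
      have h22 : (ℓ : ℤ) ∣ 2 ^ 2 := by norm_num; exact h4
      have h2 := hℓprime.dvd_of_dvd_pow h22
      have h2' : ℓ ∣ 2 := by exact_mod_cast h2
      exact hℓ2 ((Nat.prime_dvd_prime_iff_eq hℓ Nat.prime_two).mp h2')
    · exact h4
  have hpos : 0 < ℓ / 2 := Nat.div_pos hℓ.two_le two_pos
  have hℓrpow : (ℓ : ℤ) ∣ r ^ (ℓ / 2) := dvd_pow hℓr hpos.ne'
  have h1 : (ℓ : ℤ) ∣ 1 := by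
    have h := dvd_sub hr hℓrpow
    simpa using h
  exact hℓprime.not_dvd_one h1

/-! ## §2 The Frobenius of an odd prime `ℓ` with `v₂(ℓ² − 1) ≥ j + 3` lies in `Gal(ℚ̄/ℚ_j)` and moves `√r`, `√s` -/

/-- **The Galois element of the torsion certificate.** For the cyclotomic `ℤ₂`-extension `κ` of `ℚ`, a
finite place `v` of `ℚ` over an odd prime `ℓ` with `j + 3 ≤ v₂(ℓ² − 1)` (i.e. `ℓ ≡ ±1 (mod 2^{j+2})`), and
integers `r`, `s` with `ℓ ∣ r^{⌊ℓ/2⌋} + 1`, `ℓ ∣ s^{⌊ℓ/2⌋} + 1`: there is `σ ∈ κ.layerSubgroup j` (namely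
a Frobenius at `ℓ`) fixing no square root of `r` and none of `s` in `ℚ̄` — the hypotheses `hσ`, `hσr`, `hσs`
of `natCard_fixedBy_layerSubgroup_le_two`. [cite: Washington1997, §13.1] [cite: NeukirchANT1999, Ch. II §9 Prop. (9.6)]
[cite: IrelandRosen1990, Prop. 5.1.1] -/
theorem exists_mem_layerSubgroup_apply_ne {κ : ZpExtension ℚ 2} (hκ : κ.IsCyclotomic) {j : ℕ}
    (v : HeightOneSpectrum (𝓞 ℚ)) {ℓ : ℕ} (hv : natGenerator v = ℓ) (hℓ2 : ℓ ≠ 2)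
    (hj : j + 3 ≤ padicValNat 2 (ℓ ^ 2 - 1)) {r s : ℤ}
    (hr : (ℓ : ℤ) ∣ r ^ (ℓ / 2) + 1) (hs : (ℓ : ℤ) ∣ s ^ (ℓ / 2) + 1) :
    ∃ σ : absoluteGaloisGroup ℚ, σ ∈ κ.layerSubgroup j ∧
      (∀ α : AlgebraicClosure ℚ, α ^ 2 = algebraMap ℚ (AlgebraicClosure ℚ) r →
        (show AlgebraicClosure ℚ ≃ₐ[ℚ] AlgebraicClosure ℚ from σ) α ≠ α) ∧
      (∀ β : AlgebraicClosure ℚ, β ^ 2 = algebraMap ℚ (AlgebraicClosure ℚ) s →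
        (show AlgebraicClosure ℚ ≃ₐ[ℚ] AlgebraicClosure ℚ from σ) β ≠ β) := by
  have hℓ : ℓ.Prime := hv ▸ prime_natGenerator v
  have h2v : ((2 : ℕ) : 𝓞 ℚ) ∉ v.asIdeal :=
    TowerClass.two_notMem_asIdeal_of_natGenerator_ne v (by rw [hv]; exact hℓ2)
  -- a local arithmetic Frobenius at `v`, restricted to `Γ_ℚ`
  obtain ⟨τ, hτ⟩ := exists_isAbsArithFrob_holds (v.adicCompletion ℚ)
  refine ⟨Literature.NumberTheory.EllipticCurves.resGal (K := ℚ) (v.adicCompletion ℚ) τ, ?_, ?_, ?_⟩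
  · -- `‖κ σ‖ = 2^{-(v₂(ℓ²-1)-3)} ≤ 2^{-j}` ⇒ `2^j ∣ κ σ` ⇒ `σ ∈ κ.layerSubgroup j`
    have hnorm := TowerLayer.norm_toAdd_apply_resGal_of_isAbsArithFrob_two hκ v h2v hτ
    rw [hv] at hnorm
    set x := Multiplicative.toAdd (κ (Literature.NumberTheory.EllipticCurves.resGal (K := ℚ)
      (v.adicCompletion ℚ) τ)) with hx
    have hle : ‖x‖ ≤ ((2 : ℕ) : ℝ) ^ (-(j : ℤ)) := by
      rw [hnorm, Nat.cast_ofNat]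
      exact zpow_le_zpow_right₀ (by norm_num) (by omega)
    have hmem := (PadicInt.norm_le_pow_iff_mem_span_pow x j).mp hle
    exact ZpExtension.mem_layerSubgroup.mpr (Ideal.mem_span_singleton.mp hmem)
  all_goals
    -- `σ` is an arithmetic Frobenius at the prime `𝔓₀ ∣ ℓ` of `ℤ̄`
    have hq : IsNonarchimedeanLocalField.residueFieldCard (v.adicCompletion ℚ) =
        Nat.card (𝓞 ℚ ⧸ v.asIdeal) := by
      rw [Literature.NumberTheory.Automorphic.residueFieldCard_adicCompletion_eq,
        HeightOneSpectrum.residueCard_eq_card_quotient]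
    have hfrob := (isArithFrobAt_absGaloisRestrict_adicCompletionPrime_iff ℚ v hq τ).2 hτ
    have hcard : Nat.card (𝓞 ℚ ⧸ (adicCompletionPrime ℚ v).under (𝓞 ℚ)) = ℓ := by
      rw [under_adicCompletionPrime, ← HeightOneSpectrum.residueCard_eq_card_quotient,
        Rat.residueCard_eq_natGenerator, hv]
    have hmem : ∀ n : ℤ, ((n : 𝓞 ℚ) ∈ (adicCompletionPrime ℚ v).under (𝓞 ℚ)) ↔ (ℓ : ℤ) ∣ n := by
      intro n
      rw [under_adicCompletionPrime, Rat.intCast_mem_asIdeal_iff, hv]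
    intro α hα
    first
      | exact algEquiv_apply_ne_of_isArithFrobAt hfrob hℓ hℓ2 hcard hmem hr hα
      | exact algEquiv_apply_ne_of_isArithFrobAt hfrob hℓ hℓ2 hcard hmem hs hα

/-! ## §3 The layer-`j` torsion certificate from three integer facts -/

/-- **`#E[2^∞]^{Gal(ℚ̄/ℚ_j)} ≤ 2^1` from an odd prime `ℓ`** for `W/ℚ` with a rational `2`-torsion abscissa
`e₁`: if `j + 3 ≤ v₂(ℓ² − 1)` and `ℓ ∣ r^{⌊ℓ/2⌋} + 1`, `ℓ ∣ s^{⌊ℓ/2⌋} + 1` for the INTEGERS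
`r = (a₁²e₁ + a₁a₃ + 4a₂e₁ + 2a₄ + 6e₁²)/2 = ψ₂′(e₁)/4` and `s = (b₂ + 4e₁)² − 16(2b₄ + b₂e₁ + 4e₁²)`, then at
most two points of `E(ℚ̄)[2^∞]` are fixed by `Gal(ℚ̄/ℚ_j)` — the `htor` input (`t = 1`) of
`towerRank_of_layerClasses_of_torsion` / `towerRank_of_layerSelmer_of_torsion` and of the torsion-tolerant gap
doors, for EVERY `j ≤ v₂(ℓ² − 1) − 3` at once. [cite: SilvermanAEC2009, III.2.3 (d), VIII.§1]
[cite: Washington1997, §13.1] [cite: IrelandRosen1990, Prop. 5.1.1] -/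
theorem natCard_fixedBy_layerSubgroup_le_two_of_prime (W : WeierstrassCurve ℚ) {κ : ZpExtension ℚ 2}
    (hκ : κ.IsCyclotomic) {j : ℕ} (v : HeightOneSpectrum (𝓞 ℚ)) {ℓ : ℕ} (hv : natGenerator v = ℓ)
    (hℓ2 : ℓ ≠ 2) (hj : j + 3 ≤ padicValNat 2 (ℓ ^ 2 - 1)) (e₁ : ℚ) (r s : ℤ)
    (he₁ : 4 * e₁ ^ 3 + W.b₂ * e₁ ^ 2 + 2 * W.b₄ * e₁ + W.b₆ = 0)
    (hr : 2 * (r : ℚ) = W.a₁ ^ 2 * e₁ + W.a₁ * W.a₃ + 4 * W.a₂ * e₁ + 2 * W.a₄ + 6 * e₁ ^ 2)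
    (hs : (s : ℚ) = (W.b₂ + 4 * e₁) ^ 2 - 16 * (2 * W.b₄ + W.b₂ * e₁ + 4 * e₁ ^ 2))
    (hrE : (ℓ : ℤ) ∣ r ^ (ℓ / 2) + 1) (hsE : (ℓ : ℤ) ∣ s ^ (ℓ / 2) + 1) :
    Nat.card {m : geomPrimaryTorsion W 2 | ∀ τ ∈ κ.layerSubgroup j, τ • m = m} ≤ 2 ^ 1 := by
  obtain ⟨σ, hσ, hσr, hσs⟩ := exists_mem_layerSubgroup_apply_ne hκ v hv hℓ2 hj hrE hsE
  exact natCard_fixedBy_layerSubgroup_le_two W σ hσ e₁ r s he₁ hr hs hσr hσs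

end Summit.BirchSwinnertonDyer.BirchSwinnertonDyer.Theorems.TowerLambdaTorsion

end
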